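import Literature.Computability.QuantumComplexity.BosonSamplingHardness
import Literature.Computability.Complexity.OracleCompositionMachine
import Literature.Computability.Complexity.OracleEmpty
import Literature.Computability.Complexity.PairingMachines
import Literature.Computability.Complexity.PRelHierarchy
import HarnessLib

/-!
# Aaronson–Arkhipov's Main Theorem (Thm. 1.3) in its printed black-box form; Cor. 5.9 from it

Family `quantum-advantage`; companion to `BosonSamplingHardness.lean` (the corrected form of
statement **quantum-advantage.S21** and its ingredients). Source: S. Aaronson, A. Arkhipov, *The
computational complexity of linear optics*, Theory of Computing 9 (2013) 143–252 (AA13; journal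
numbering and pagination: Def. 3.11 p. 174, Thm. 1.3 p. 152 and its restatement p. 192, proof
§5.2 pp. 192–195, Cor. 5.9 p. 195, Def. 2.3 p. 162, Thm. 1.1 p. 149).

`BosonSamplingHardness.lean` vendors AA13's main result in the *tree form* of Cor. 5.9, first
sentence: `gpeSolvableInFBPPRel_NP_of_uniformApproxBosonSampling` ("BosonSampling `∈ SampP` ⟹
`|GPE|²_± ∈ FBPP^{NP}`"). The printed Main Theorem is the black-box statement

> **Theorem 1.3** (restated, p. 192). *Let `𝒪` be any approximate BosonSampling oracle. Then
> `|GPE|²_± ∈ FBPP^{NP^𝒪}`.*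

for oracles in the sense of

> **Definition 3.11** (p. 174). *Let `𝒪` be an oracle that takes as input a string
> `r ∈ {0,1}^{poly(n)}`, an `m × n` matrix `A ∈ 𝒰_{m,n}` and an error bound `ε > 0` encoded as
> `0^{1/ε}`. Also, let `𝒟_𝒪(A, ε)` be the distribution over outputs of `𝒪` if `A` and `ε` are
> fixed but `r` is uniformly random. … we call `𝒪` an approximate BosonSampling oracle if
> `‖𝒟_𝒪(A, ε) − 𝒟_A‖ ≤ ε` for all `A ∈ 𝒰_{m,n}` and `ε > 0`* (`‖·‖` = total variation
> distance, p. 151),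

and Cor. 5.9 (p. 195, printed without proof) reads: *Suppose BosonSampling `∈ SampP`. Then
`|GPE|²_± ∈ FBPP^{NP}`. Indeed, even under the hypothesis BosonSampling `∈ SampP^{PH}` we have
`|GPE|²_± ∈ FBPP^{PH}`.*

This file

* defines Def. 3.11 in the tree's oracle model (`oracleCoinPMF`, `oracleSamplePMF`,
  `IsApproxBosonSamplingOracle`; same input format, outcome encoding and precision convention as
  `IsApproxBosonSampler`) and "BosonSampling `∈ SampP^{C}`" for an oracle class `C`
  (`ApproxBosonSamplingInSampPRel C`: the sampler is an `FP^{L}` transducer, `L ∈ C`, reading its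
  coins from the query);
* vendors **Theorem 1.3 verbatim** as the named fact
  `gpeSolvableInFBPPRel_NPRel_of_approxBosonSamplingOracle :
   ∀ O, IsApproxBosonSamplingOracle O → GPESolvableInFBPPRel (NPRel O)`;
* **proves both sentences of Corollary 5.9 from it**:
  `gpeSolvableInFBPPRel_NP_of_uniformApproxBosonSampling_of_mainTheorem` (a uniform `SampP`
  sampler `A` *is* an approximate BosonSampling oracle `coinOracleOf A ∈ FP`, and `NP^{𝒪} ⊆ NP`
  for `𝒪 ∈ FP`) and `gpeSolvableInFBPPRel_PH_of_sampPRel_PH` (`𝒪 ∈ FP^{L}`, `L ∈ Σₖᵖ` ⟹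
  `NP^{𝒪} ⊆ NP^{L} ⊆ Σₖ₊₃ᵖ ⊆ PH`), using the tree's proved oracle-machine composition
  `OracleAlg.PRel_subset_PRel_of_mem_FPRel` (`OracleCompositionMachine.lean`), `P^∅ = P`
  (`OracleEmpty.lean`) and `P^{Σₖ} ⊆ Πₖ₊₂` (`PRelHierarchy.lean`);
* and records the consequence for S21: the corrected statement
  `PSharpP_subset_BPPRelClass_NP_of_uniformApproxBosonSampling` now rests on Theorem 1.3 alone
  (`…_of_mainTheorem`), and the `PH` variant of the Fig. 2 chain
  (`PSharpP_subset_BPPRelClass_PH_of_sampPRel_PH`).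

So after this file the only unproved ingredient of the Aaronson–Arkhipov chain in the tree is the
printed Main Theorem itself (whose proof, §5.2, needs a finite-precision version of the Hiding
Lemma 5.8 together with Stockmeyer counting relative to `𝒪` and `PostBPP ⊆ BPP^{NP}`; see the
module docstring of `BosonSamplingHardness.lean`, "What a discharge of the Thm. 1.3 fact would
need", and the companion files `HaarUnitaryHiding.lean`, `RejectionSampling.lean`,
`Complexity/ApproximateCounting.lean`).

## Design choices

* **Queries of a coin-taking sampler oracle** are `boolPair x' r` with `x' = boolPair x (1^k)`
  the deterministic part (instance `x = encode ⟨n, e, b, round_b U⟩` and accuracy `k = 1/ε` in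
  unary, exactly the input of `RandAlg.samplePMF`) and `r` the coin block, of length `c(|x'|)`
  for a polynomial `c` that comes with the oracle (Def. 3.11: `r ∈ {0,1}^{poly(n)}`; the
  `BPP^{NP^𝒪}` machine of Thm. 1.3 has to generate `r`, so its length must be a polynomial it can
  evaluate — with an arbitrary polynomially *bounded* length the oracle would receive advice, cf.
  hypothesis (2) in `BosonSamplingHardness.lean`). `oracleCoinPMF O c x'` is `𝒟_𝒪` at the query
  `x'`. With this convention a uniform sampler `A` (`coinLen = q`) literally *is* the oracle
  `coinOracleOf A := fun z ↦ A.run (boolUnpair z).1 (boolUnpair z).2` with `c = q`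
  (`oracleSamplePMF_coinOracleOf`), which is AA13's reading of a randomised algorithm as "a
  deterministic algorithm that takes a random string `r` as part of its input" (Thm. 1.1, p. 149).
* **`FBPP^{NP^𝒪}`** is read, as `GPESolvableInFBPPRel` reads `FBPP^{C}`, as: for some
  `L ∈ NP^𝒪 = NPRel O` an `FP^{L}` transducer reading its coins from the query solves `|GPE|²_±`
  jointly over the Gaussian input and the coins. (A machine using several `NP^𝒪` languages, or
  `𝒪` itself — whose answer bits are decidable in `P^𝒪 ⊆ NP^𝒪` — uses their marked union, again
  in `NP^𝒪`.)
* **Faithfulness of the hypothesis.** `IsApproxBosonSamplingOracle` constrains `𝒪` on ordered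
  mode assignments (a refinement of AA13's occupation-number outcomes `Φ_{m,n}`; forgetting the
  order is a push-forward computable in `FP^𝒪` and contracts total variation) and on the `b`-bit
  roundings of every column-orthonormal `U` above a polynomial precision threshold chosen with
  the oracle (AA13 §2, p. 161: "a fixed polynomial `p` such that none of the relevant calculations
  are affected by precision issues"). Every oracle satisfying it yields, by that push-forward, an
  oracle `𝒪♭ ∈ FP^𝒪` satisfying Def. 3.11 in AA13's own outcome format, with `NP^{𝒪♭} ⊆ NP^𝒪`
  (`NPRel_subset_NPRel_of_mem_FPRel`); so the fact below asserts no more than the printed theorem.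

## References

* S. Aaronson, A. Arkhipov, *The computational complexity of linear optics*, Theory of Computing
  9 (2013) 143–252: Def. 3.11, Thm. 1.3 (pp. 152, 192–195), Cor. 5.9, Def. 2.3–2.4, Thm. 1.1.
* S. Arora, B. Barak, *Computational Complexity: A Modern Approach*, CUP 2009, §3.4 (oracle
  machines, Example 3.6 (2)), Def. 5.3 (`Σₖᵖ`), §7.1 (coins as input).
* L. Stockmeyer, *The polynomial-time hierarchy*, Theoret. Comput. Sci. 3 (1976), §3
  (`NP(Σₖ) = Σₖ₊₁`, used here in the tree's proved two-level form `P^{Σₖ} ⊆ Πₖ₊₂`).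
-/

open MeasureTheory Matrix Computability Literature.Computability.Complexity Literature.Computability.Complexity.Nondeterministic Literature.Computability.Cryptography

namespace Literature.Computability.QuantumComplexity

/-! ### Coin-taking sampler oracles (AA13 Def. 3.11) -/

/-- `oracleCoinPMF O c x'` — AA13's `𝒟_𝒪` at the deterministic query part `x'`: the distribution
of the answer `O (boolPair x' r)` for a uniformly random coin block `r ∈ {0,1}^{c(|x'|)}` ("the
distribution over outputs of `𝒪` if `A` and `ε` are fixed but `r` is uniformly random").
[cite: AaronsonArkhipovToC2013, Def. 3.11 (p. 174)] -/
noncomputable def oracleCoinPMF (O : Oracle) (c : Polynomial ℕ) (x : List Bool) : PMF (List Bool) :=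
  (PMF.uniformOfFintype (List.Vector Bool (c.eval x.length))).map fun r => O (boolPair x r.toList)

/-- `oracleSamplePMF O c x k = 𝒟_𝒪(x, ε)` with `ε = 1/k`: the output distribution of the
coin-taking oracle `O` on the padded instance `⟨x, 1^k⟩ = boolPair x (unaryEncodeNat k)` (the
input convention of `RandAlg.samplePMF` and of AA13's `⟨A, 0^{1/ε}⟩`).
[cite: AaronsonArkhipovToC2013, Def. 3.11 (p. 174)] -/
noncomputable def oracleSamplePMF (O : Oracle) (c : Polynomial ℕ) (x : List Bool) (k : ℕ) :
    PMF (List Bool) :=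
  oracleCoinPMF O c (boolPair x (unaryEncodeNat k))

/-- `IsApproxBosonSamplingOracle O`: the coin-taking oracle `O` is an **approximate
BosonSampling oracle** (AA13 Def. 3.11: "`‖𝒟_𝒪(A, ε) − 𝒟_A‖ ≤ ε` for all `A ∈ 𝒰_{m,n}` and
`ε > 0`"), in the tree's input format and with the conventions of `IsApproxBosonSampler`: there
are polynomials `p₀` (precision threshold, AA13 §2 p. 161) and `c` (coin length) such that for
every column-orthonormal `U ∈ 𝒰_{n+e,n}`, every accuracy `k ≥ 1` (`ε = 1/k`) and every precision
`b ≥ p₀ (n + e + k)`, the answers of `O` on `⟨⟨n, e, b, round_b U⟩, 1^k⟩` with uniformly random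
coins of length `c(·)` are within total variation distance `1/k` of `𝒟_U` (`bosonTargetPMF U`,
ordered mode assignments; module docstring, "Faithfulness of the hypothesis").
[cite: AaronsonArkhipovToC2013, Def. 3.11 (p. 174) with §2 (p. 161)] -/
def IsApproxBosonSamplingOracle (O : Oracle) : Prop :=
  ∃ p₀ c : Polynomial ℕ, ∀ (n e b k : ℕ) (U : Matrix (Fin (n + e)) (Fin n) ℂ),
    IsColumnOrthonormal U → 0 < k → p₀.eval (n + e + k) ≤ b →
      (oracleSamplePMF O c (encodingBosonInput.encode ⟨n, e, b, roundEntries b U⟩) k).tvDist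
          (bosonTargetPMF U) ≤ 1 / (k : ℝ)

/-- `ApproxBosonSamplingInSampPRel C` — "BosonSampling `∈ SampP^{C}`" (AA13 Def. 2.3 relative to
an oracle class, as in Cor. 5.9's `SampP^{PH}`), with Def. 3.11's convention for the sampler's
coins: for some language `L ∈ C` there is a deterministic polynomial-time oracle transducer with
oracle `L` (`O ∈ FPRel (Oracle.ofLanguage L)`) which, reading its coins from the query, is an
approximate BosonSampling oracle. [cite: AaronsonArkhipovToC2013, Def. 2.3 (p. 162) with Cor. 5.9 (p. 195) and Def. 3.11 (p. 174)] -/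
def ApproxBosonSamplingInSampPRel (C : Set (Language Bool)) : Prop :=
  ∃ L ∈ C, ∃ O ∈ FPRel (Oracle.ofLanguage L), IsApproxBosonSamplingOracle O

/-! ### The Main Theorem, as printed (named fact) -/

/-- **AA13 Theorem 1.3 (Main Result), black-box form, as restated and proved in §5.2 (p. 192):**
"Let `𝒪` be any approximate BosonSampling oracle. Then `|GPE|²_± ∈ FBPP^{NP^𝒪}`." In the tree's
model: for every coin-taking oracle `O` satisfying Def. 3.11 (`IsApproxBosonSamplingOracle O`)
there are a language `L ∈ NP^{O}` (`NPRel O`) and a deterministic polynomial-time transducer with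
oracle `L`, reading its coins from the query, that estimates `|Per X|²` to within `± ε · n!`
except with probability `< δ` jointly over `X ∼ 𝒩(0,1)_ℂ^{n×n}` and its coins
(`GPESolvableInFBPPRel (NPRel O)`; Problem 1.2 with eqs. (5.96)–(5.97)). Printed proof (§5.2,
pp. 192–195): embed `X/√m` as a random `n × n` submatrix of a Haar-random `A ∈ 𝒰_{m,n}`,
`m = (K n⁵/δ) log²(n/δ)` (Hiding Lemma 5.8, in `BPP^{NP}` by `PostBPP ⊆ BPP^{NP}`, from the
Haar-unitary hiding Thm. 5.2 and rejection sampling Lemma 5.7); query `𝒪` on `⟨A, 0^{1/β}, r⟩`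
with `β = εδ/24`; estimate the probability `q_{S*}` of the planted outcome over `r` by
Stockmeyer approximate counting in `FBPP^{NP^𝒪}` (Thm. 4.1); conclude by Markov's inequality and
the symmetry of `S*` given `A` ((5.78)–(5.97)). Not proved here: beyond approximate counting and
`PostBPP ⊆ BPP^{NP}` (named facts in `Complexity/ApproximateCounting.lean`), the printed procedure
postselects on `X/√m` occurring *exactly* as a submatrix of a real-valued `A` (p. 192), which is
meaningful only at the finite precision §2 leaves implicit; a proof has to supply that
finite-precision hiding procedure and its error accounting.
[cite: AaronsonArkhipovToC2013, Thm. 1.3 (p. 152; restated p. 192, proof §5.2 pp. 192–195)] -/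
def gpeSolvableInFBPPRel_NPRel_of_approxBosonSamplingOracle : Prop :=
  ∀ O : Oracle, IsApproxBosonSamplingOracle O → GPESolvableInFBPPRel (NPRel O)

/-! ### Uniform samplers are approximate BosonSampling oracles in `FP` -/

/-- The randomised algorithm `A` read as a coin-taking oracle: on the query `boolPair x r` answer
`A.run x r` (other strings through `boolUnpair`'s junk convention) — "a deterministic algorithm
that takes a random string `r` as part of its input" (AA13 Thm. 1.1, p. 149; Arora–Barak 2009,
§7.1). [cite: AaronsonArkhipovToC2013, Thm. 1.1 (p. 149)] -/
def coinOracleOf (A : RandAlg (List Bool) (List Bool)) : Oracle :=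
  fun z => A.run (boolUnpair z).1 (boolUnpair z).2

/-- On a well-formed query the coin-taking oracle of `A` runs `A`. [folklore] -/
@[simp] theorem coinOracleOf_boolPair (A : RandAlg (List Bool) (List Bool)) (x r : List Bool) :
    coinOracleOf A (boolPair x r) = A.run x r := by
  simp [coinOracleOf]

/-- Pushing the uniform distribution on coin strings forward along `r ↦ g r` does not depend on
how the (equal) coin length is written (transport along `m = m'`). [folklore] -/
theorem map_uniformVector_congr (g : List Bool → List Bool) {m m' : ℕ} (h : m = m') :
    (PMF.uniformOfFintype (List.Vector Bool m)).map (fun r => g r.toList) =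
      (PMF.uniformOfFintype (List.Vector Bool m')).map (fun r => g r.toList) := by
  subst h
  rfl

/-- For a sampler with coin budget exactly `q`, `𝒟_𝒪` of its coin-taking oracle with coin length
`q` is its output distribution. [cite: AaronsonArkhipovToC2013, Thm. 1.1 (p. 149) with Def. 3.11 (p. 174)] -/
theorem oracleCoinPMF_coinOracleOf (A : RandAlg (List Bool) (List Bool)) {q : Polynomial ℕ}
    (hq : ∀ n, A.coinLen n = q.eval n) (x : List Bool) :
    oracleCoinPMF (coinOracleOf A) q x = A.outputPMF id x := by
  unfold oracleCoinPMF RandAlg.outputPMF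
  simp only [coinOracleOf_boolPair]
  exact map_uniformVector_congr (A.run x) (hq _).symm

/-- Hence `𝒟_𝒪(x, 1/k)` of the coin-taking oracle of a uniform sampler is `A.samplePMF x k`.
[cite: AaronsonArkhipovToC2013, Def. 3.11 (p. 174) with Def. 2.3 (p. 162)] -/
theorem oracleSamplePMF_coinOracleOf (A : RandAlg (List Bool) (List Bool)) {q : Polynomial ℕ}
    (hq : ∀ n, A.coinLen n = q.eval n) (x : List Bool) (k : ℕ) :
    oracleSamplePMF (coinOracleOf A) q x k = A.samplePMF x k := by
  unfold oracleSamplePMF RandAlg.samplePMF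
  exact oracleCoinPMF_coinOracleOf A hq _

/-- **A uniform approximate BosonSampling sampler is an approximate BosonSampling oracle** (with
its own coin polynomial as the coin length). [cite: AaronsonArkhipovToC2013, Def. 3.11 (p. 174) with Def. 2.3 (p. 162)] -/
theorem IsApproxBosonSampler.isApproxBosonSamplingOracle {A : RandAlg (List Bool) (List Bool)}
    (h : IsApproxBosonSampler A) {q : Polynomial ℕ} (hq : ∀ n, A.coinLen n = q.eval n) :
    IsApproxBosonSamplingOracle (coinOracleOf A) := by
  obtain ⟨p₀, hp⟩ := h
  refine ⟨p₀, q, fun n e b k U hU hk hb => ?_⟩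
  rw [oracleSamplePMF_coinOracleOf A hq]
  exact hp n e b k U hU hk hb

/-- **The coin-taking oracle of a PPT algorithm is in `FP`**: compose the polynomial-time map
`boolPair x r ↦ A.run x r` (`IsPPT`) with the polynomial-time un-pairing
(`polyTimeComputable_boolUnpair`). [cite: AroraBarak2009, §7.1 with Claim 1.6] -/
theorem coinOracleOf_mem_FP {A : RandAlg (List Bool) (List Bool)} (hA : IsPPT A id) :
    coinOracleOf A ∈ FP :=
  PolyTimeComputable.comp_holds hA.1 polyTimeComputable_boolUnpair

/-! ### Relativisation plumbing -/

/-- `FP ⊆ FP^O` for every oracle: a polynomial-time function is a query-free oracle transducer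
(`OracleAlg.ofFun`, one round, no queries; `OracleAlg.isPolyTime_ofFun_holds`), the function
analogue of `P_subset_PRel_holds`. [cite: BakerGillSolovay1975, §1] -/
theorem FP_subset_FPRel (O : Oracle) : FP ⊆ FPRel O := by
  intro f hf
  refine ⟨OracleAlg.ofFun f, OracleAlg.isPolyTime_ofFun_holds hf, 1, fun x => ⟨?_, ?_⟩⟩
  · rw [Polynomial.eval_one]
    rfl
  · simp

/-- `f ∈ FP^O ⟹ NP^f ⊆ NP^O`: the proved composition `P^f ⊆ P^O`
(`OracleAlg.PRel_subset_PRel_of_mem_FPRel`) under the monotone certificate operator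
(`NPRel O = ∃ᵖ·P^O`). [cite: AroraBarak2009, §3.4 Example 3.6 (2) with Def. 5.3] -/
theorem NPRel_subset_NPRel_of_mem_FPRel {O f : Oracle} (hf : f ∈ FPRel O) : NPRel f ⊆ NPRel O :=
  polyExists_mono (OracleAlg.PRel_subset_PRel_of_mem_FPRel hf)

/-- `f ∈ FP ⟹ NP^f ⊆ NP` ("if `O ∈ P` then the oracle gives no power", Arora–Barak Example
3.6 (2), for function oracles and `NP`): `NP^f ⊆ NP^∅ = NP` (`FP_subset_FPRel`,
`NPRel_subset_NPRel_of_mem_FPRel`, `NPRel_empty`). This is the step from Thm. 1.3 to Cor. 5.9.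
[cite: AroraBarak2009, §3.4 Example 3.6 (2)] -/
theorem NPRel_subset_NP_of_mem_FP {f : Oracle} (hf : f ∈ FP) : NPRel f ⊆ NP := by
  rw [← NPRel_empty]
  exact NPRel_subset_NPRel_of_mem_FPRel (FP_subset_FPRel Oracle.empty hf)

/-- `NP^L ⊆ NP^C` for `L ∈ C` (`NPRelClass C = ⋃_{L ∈ C} NP^L`). [cite: AroraBarak2009, §5.5] -/
theorem NPRel_ofLanguage_subset_NPRelClass {C : Set (Language Bool)} {L : Language Bool}
    (hL : L ∈ C) : NPRel (Oracle.ofLanguage L) ⊆ NPRelClass C :=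
  fun _ hK => Set.mem_biUnion hL hK

/-- `L ∈ PH ⟹ NP^L ⊆ PH`: for `L ∈ Σₖᵖ`, `P^L ⊆ Πₖ₊₂ᵖ` (`PRel_ofLanguage_subset_PiP_add_two`,
the tree's proved two-level form of Stockmeyer's `P^{Σₖ} ⊆ Σₖ₊₁ ∩ Πₖ₊₁`), hence
`NP^L = ∃ᵖ·P^L ⊆ ∃ᵖ·Πₖ₊₂ᵖ = Σₖ₊₃ᵖ`. [cite: Stockmeyer1976, §3 (inclusion structure) with Thm. 3.1] -/
theorem NPRel_ofLanguage_subset_PH {L : Language Bool} (hL : L ∈ PH) :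
    NPRel (Oracle.ofLanguage L) ⊆ PH := by
  simp only [PH, Set.mem_iUnion] at hL
  obtain ⟨k, hk⟩ := hL
  intro K hK
  have hK' : K ∈ SigmaP (k + 2 + 1) := by
    rw [SigmaP_succ]
    exact polyExists_mono (PRel_ofLanguage_subset_PiP_add_two hk) hK
  exact SigmaP_subset_PH _ hK'

/-- Hence `NP^{PH} ⊆ PH`. [cite: Stockmeyer1976, §3 (inclusion structure) with Thm. 3.1] -/
theorem NPRelClass_PH_subset_PH : NPRelClass PH ⊆ PH :=
  Set.iUnion₂_subset fun _ hL => NPRel_ofLanguage_subset_PH hL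

/-! ### Corollary 5.9 from Theorem 1.3 (proved) -/

/-- **Thm. 1.3 relative to a sampler in `SampP^{C}`**: if BosonSampling `∈ SampP^{C}` then
`|GPE|²_± ∈ FBPP^{NP^C}` — the sampler `O ∈ FP^{L}` (`L ∈ C`) is an approximate BosonSampling
oracle, and `NP^{O} ⊆ NP^{L} ⊆ NP^{C}`. [cite: AaronsonArkhipovToC2013, Thm. 1.3 (p. 152) with Cor. 5.9 (p. 195)] -/
theorem gpeSolvableInFBPPRel_NPRelClass_of_sampPRel
    (h13 : gpeSolvableInFBPPRel_NPRel_of_approxBosonSamplingOracle) {C : Set (Language Bool)}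
    (h : ApproxBosonSamplingInSampPRel C) : GPESolvableInFBPPRel (NPRelClass C) := by
  obtain ⟨L, hL, O, hO, hS⟩ := h
  exact (h13 O hS).mono
    ((NPRel_subset_NPRel_of_mem_FPRel hO).trans (NPRel_ofLanguage_subset_NPRelClass hL))

/-- **AA13 Corollary 5.9, first sentence, from Theorem 1.3**: "Suppose BosonSampling `∈ SampP`.
Then `|GPE|²_± ∈ FBPP^{NP}`" — i.e. the tree-form fact
`gpeSolvableInFBPPRel_NP_of_uniformApproxBosonSampling` of `BosonSamplingHardness.lean` follows
from the black-box Main Theorem: a uniform sampler `A` is the approximate BosonSampling oracle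
`coinOracleOf A ∈ FP` (`IsApproxBosonSampler.isApproxBosonSamplingOracle`, `coinOracleOf_mem_FP`),
and `NP^{𝒪} ⊆ NP` for `𝒪 ∈ FP` (`NPRel_subset_NP_of_mem_FP`). (Printed without proof.)
[cite: AaronsonArkhipovToC2013, Cor. 5.9 (p. 195) with Thm. 1.3 (p. 152)] -/
theorem gpeSolvableInFBPPRel_NP_of_uniformApproxBosonSampling_of_mainTheorem
    (h13 : gpeSolvableInFBPPRel_NPRel_of_approxBosonSamplingOracle) :
    gpeSolvableInFBPPRel_NP_of_uniformApproxBosonSampling := by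
  rintro ⟨A, hA, ⟨q, hq⟩, hS⟩
  exact (h13 _ (hS.isApproxBosonSamplingOracle hq)).mono
    (NPRel_subset_NP_of_mem_FP (coinOracleOf_mem_FP hA))

/-- **AA13 Corollary 5.9, second sentence, from Theorem 1.3**: "even under the hypothesis
BosonSampling `∈ SampP^{PH}` we have `|GPE|²_± ∈ FBPP^{PH}`" (`NP^{PH} ⊆ PH`).
[cite: AaronsonArkhipovToC2013, Cor. 5.9 (p. 195) with Thm. 1.3 (p. 152)] -/
theorem gpeSolvableInFBPPRel_PH_of_sampPRel_PH
    (h13 : gpeSolvableInFBPPRel_NPRel_of_approxBosonSamplingOracle)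
    (h : ApproxBosonSamplingInSampPRel PH) : GPESolvableInFBPPRel PH :=
  (gpeSolvableInFBPPRel_NPRelClass_of_sampPRel h13 h).mono NPRelClass_PH_subset_PH

/-! ### Consequences for the corrected S21 -/

/-- **The corrected S21 from the printed Main Theorem alone**: PGC (coin-taking form) and a
uniform approximate BosonSampling sampler give `P^{#P} ⊆ BPP^{NP}` — Thm. 1.3 ⟹ Cor. 5.9
(`…_of_mainTheorem`) ⟹ Fig. 2 chain (`…_of_facts`, whose composition hypothesis `P^{FP^O} ⊆ P^O`
is the proved `OracleAlg.PRel_subset_PRel_of_mem_FPRel`). [cite: AaronsonArkhipovToC2013, Fig. 2 (p. 154) with Thm. 1.3, Cor. 5.9 and Conj. 1.5] -/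
theorem PSharpP_subset_BPPRelClass_NP_of_uniformApproxBosonSampling_of_mainTheorem
    (h13 : gpeSolvableInFBPPRel_NPRel_of_approxBosonSamplingOracle) :
    PSharpP_subset_BPPRelClass_NP_of_uniformApproxBosonSampling :=
  PSharpP_subset_BPPRelClass_NP_of_uniformApproxBosonSampling_of_facts
    (gpeSolvableInFBPPRel_NP_of_uniformApproxBosonSampling_of_mainTheorem h13)
    fun _ _ hf => OracleAlg.PRel_subset_PRel_of_mem_FPRel hf

/-- **The `PH` variant of the Fig. 2 chain**: PGC (coin-taking form), Thm. 1.3 and BosonSampling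
`∈ SampP^{PH}` give `P^{#P} ⊆ BPP^{PH}` (Cor. 5.9, second sentence, fed to the Fig. 2 step
`PSharpP_subset_BPPRelClass_of_gpeSolvableInFBPPRel`). [cite: AaronsonArkhipovToC2013, Cor. 5.9 (p. 195) with Fig. 2 (p. 154) and Conj. 1.5 (p. 153)] -/
theorem PSharpP_subset_BPPRelClass_PH_of_sampPRel_PH (hPGC : PermanentOfGaussiansConjectureRand)
    (h13 : gpeSolvableInFBPPRel_NPRel_of_approxBosonSamplingOracle)
    (h : ApproxBosonSamplingInSampPRel PH) : PSharpP ⊆ BPPRelClass PH :=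
  PSharpP_subset_BPPRelClass_of_gpeSolvableInFBPPRel hPGC
    (fun _ _ hf => OracleAlg.PRel_subset_PRel_of_mem_FPRel hf)
    (gpeSolvableInFBPPRel_PH_of_sampPRel_PH h13 h)

end Literature.Computability.QuantumComplexity
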